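import Summits.Ventures.PercRepro.RankDistBottomCumulative
import Summits.Ventures.PercRepro.RankDistTightPos
import Summits.Ventures.PercRepro.RankLevelSetBiIndepProfile

/-!
# PercRepro — THE BOTTOM-CUMULATIVE INEQUALITY (BC) FROM THE ULC OF THE BI-INDEPENDENT PROFILE (p9, gen 24)

The row (BC) `BottomCumulativeTop M p q` (`RankDistBottomCumulative`, p9 g23): `#𝓑·C(n,v) ≤ s_v·C(n,q)` for every
`q ≤ v ≤ p` on the tight layer `n = |E| = p + q`, `ρ(E) = p`. This file records that (BC) is NOT an open candidate:
it is the `𝒜 = 𝒵` level-wise instance of C-044 UP at the tight layer, which night-1 g23 proved CONDITIONALLY on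
the named Lorentzian fact `BiIndepULC M` (`RankLevelSetBiIndepProfile`, p605721: the profile `D_r = #{S : |S| = r,
S and E ∖ S independent}` has `D_r/C(n,r)` log-concave without internal zeros — Anari–Liu–Oveis Gharan–Vinzant 2018 /
Brändén–Huh 2020 applied to two copies of the homogenised independence polynomial), and both ends of (BC) are
unconditional (`card_Uq_le_card_shadowLev`, `card_Uq_le_card_shadowLev_top`). The bridge is three identifications in
the `RankDist` vocabulary of this lane:
* `biIndep_eq_coe_indepShadow`, `biIndepCount_eq_card_indepShadow` — night-1's bi-independent `u`-sets are exactly the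
  INDEPENDENT shadow sets `i_u` of g19 (`mem_indepShadow_iff_tight`): `D_u = i_u`;
* `card_Uq_eq_card_indepShadow_q` — the bottom sets are the independent shadow sets of level `q`: `#𝓑 = i_q = D_q`;
* `indepShadow_cumulative_of_biIndepULC` — **the independent part of Observation H** (g19): `i_q·C(n,v) ≤ i_v·C(n,q)`
  for every `q ≤ v ≤ p`, from the ULC of `D` and the symmetry `D_{n−u} = D_u` through night-1's sequence lemma
  `lc_symm_ge` (a positive log-concave sequence with equal ends is `≥` its end value);
* `indepShadowCumulative_of_biIndepULC` — g19's `IndepShadowCumulative M p q` (the independent half of the split of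
  (SC), `RankDistTightSplit`) modulo the fact; the dependent half is FALSE (the books, `RankDistBookSum`);
* **`bottomCumulativeTop_of_biIndepULC`** — (BC) on every tight layer, CONDITIONAL on `BiIndepULC M` (`i_v ≤ s_v`);
* `rls_tight_of_biIndepULC` — C-025 on the tight layer through (BC) (already unconditional by Theorem M; recorded
  only as the end of the chain).
Nothing here moves any window of the crux; the only gap of the row (BC) is the cited Lorentzian theorem, which Mathlib
does not have. Every declaration has a docstring; imports: the cell's own modules and Mathlib only.
-/

namespace PercRepro.RankDist

open Set Finset _root_.Matroid PercRepro.ThmH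

variable {α : Type} [DecidableEq α] (M : Matroid α) [M.Finite]

/-- **Night-1's bi-independent `u`-sets are the independent shadow sets of level `u`** (tight layer): both are the
sets `A ⊆ E` with `|A| = u`, `A` and `E ∖ A` independent. -/
theorem biIndep_eq_coe_indepShadow {p q : ℕ} (hn : (gr M).card = p + q) (hr : M.eRank = (p : ℕ∞)) (u : ℕ) :
    biIndep M u = ((indepShadow M p q u : Finset (Set α)) : Set (Set α)) := by
  ext A
  rw [Finset.mem_coe, mem_indepShadow_iff_tight M hn hr]
  rfl

/-- **`D_u = i_u`**: the bi-independent profile is the independent shadow profile of the tight layer. -/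
theorem biIndepCount_eq_card_indepShadow {p q : ℕ} (hn : (gr M).card = p + q) (hr : M.eRank = (p : ℕ∞))
    (u : ℕ) : biIndepCount M u = (indepShadow M p q u).card := by
  unfold biIndepCount
  rw [biIndep_eq_coe_indepShadow M hn hr u, Set.ncard_coe_finset]

/-- An independent shadow set of level `q` is (the coercion of) a bottom set: the bottom set it contains has the
same `q` elements. -/
theorem exists_mem_Uq_coe_eq_of_mem_indepShadow {p q : ℕ} (hn : (gr M).card = p + q)
    (hr : M.eRank = (p : ℕ∞)) {A : Set α} (hA : A ∈ indepShadow M p q q) :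
    ∃ B ∈ PerFlat.Uq M p q, (B : Set α) = A := by
  have hA' := hA
  rw [mem_indepShadow_iff_tight M hn hr] at hA'
  obtain ⟨hAE, hAq, -, -⟩ := hA'
  rw [mem_indepShadow, mem_shadowLev] at hA
  obtain ⟨⟨-, -, B, hB, hBA⟩, -⟩ := hA
  refine ⟨B, hB, ?_⟩
  have hBq : B.card = q := ((mem_Uq_tight M hn hr).1 hB).2.2.1
  exact Set.eq_of_subset_of_ncard_le hBA (by rw [Set.ncard_coe_finset, hBq, hAq])
    (M.ground_finite.subset hAE)

open scoped Classical in
/-- **`#𝓑 = i_q`**: the bottom sets are the independent shadow sets of level `q` (tight layer). -/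
theorem card_Uq_eq_card_indepShadow_q {p q : ℕ} (hn : (gr M).card = p + q) (hr : M.eRank = (p : ℕ∞)) :
    (PerFlat.Uq M p q).card = (indepShadow M p q q).card := by
  refine Finset.card_nbij' (fun B => (B : Set α)) (fun A => (gr M).filter (fun e => e ∈ A)) ?_ ?_ ?_ ?_
  · intro B hB
    rw [Finset.mem_coe] at hB ⊢
    exact coe_mem_indepShadow_of_mem_Uq M hn hr hB
  · intro A hA
    rw [Finset.mem_coe] at hA ⊢
    obtain ⟨B, hB, hBA⟩ := exists_mem_Uq_coe_eq_of_mem_indepShadow M hn hr hA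
    have hAE : A ⊆ M.E := ((mem_indepShadow_iff_tight M hn hr).1 hA).1
    have hfilt : ((gr M).filter (fun e => e ∈ A) : Finset α) = B := by
      apply Finset.coe_injective
      rw [coe_filter_mem_gr M hAE, hBA]
    show ((gr M).filter (fun e => e ∈ A) : Finset α) ∈ PerFlat.Uq M p q
    rw [hfilt]; exact hB
  · intro B hB
    rw [Finset.mem_coe] at hB
    have hBE : (B : Set α) ⊆ M.E := by
      rw [← coe_gr M]; exact Finset.coe_subset.2 ((mem_Uq_tight M hn hr).1 hB).1
    apply Finset.coe_injective
    exact coe_filter_mem_gr M hBE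
  · intro A hA
    rw [Finset.mem_coe] at hA
    exact coe_filter_mem_gr M ((mem_indepShadow_iff_tight M hn hr).1 hA).1

/-- **`#𝓑 = D_q`**: the bottom sets are the bi-independent `q`-sets. -/
theorem card_Uq_eq_biIndepCount {p q : ℕ} (hn : (gr M).card = p + q) (hr : M.eRank = (p : ℕ∞)) :
    (PerFlat.Uq M p q).card = biIndepCount M q := by
  rw [card_Uq_eq_card_indepShadow_q M hn hr, biIndepCount_eq_card_indepShadow M hn hr q]

omit [DecidableEq α] in
/-- **The bi-independent profile is cumulative from its ULC** (tight layer, both ends included):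
`C(p+q, v)·D_q ≤ C(p+q, q)·D_v` for every `q ≤ v ≤ p`, CONDITIONAL on `BiIndepULC M` — night-1's
`levelHallUp_members_of_biIndepULC` with the ends `v = q`, `v = p` admitted (there the two sides agree). -/
theorem biIndepCount_mul_choose_le_of_biIndepULC (hULC : BiIndepULC M) {p q v : ℕ}
    (hE : M.E.ncard = p + q) (hqv : q ≤ v) (hvp : v ≤ p) :
    ((p + q).choose v : ℚ) * (biIndepCount M q : ℚ) ≤ ((p + q).choose q : ℚ) * (biIndepCount M v : ℚ) := by
  obtain ⟨hlc, hnz⟩ := hULC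
  have hsym : biIndepCount M p = biIndepCount M q := by
    have := biIndepCount_compl M q (by omega)
    rwa [hE, show p + q - q = p by omega] at this
  by_cases hq0 : biIndepCount M q = 0
  · rw [hq0]; simp only [Nat.cast_zero, mul_zero]; positivity
  have hqpos : 0 < biIndepCount M q := Nat.pos_of_ne_zero hq0
  have hppos : 0 < biIndepCount M p := by rwa [hsym]
  have hpos : ∀ r, q ≤ r → r ≤ p → 0 < biIndepNorm M r := by
    intro r hqr hrp
    unfold biIndepNorm
    have hD : 0 < biIndepCount M r := hnz q r p hqr hrp hqpos hppos
    have hC : 0 < ((M.E.ncard).choose r : ℚ) := by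
      exact_mod_cast Nat.choose_pos (by omega)
    exact div_pos (by exact_mod_cast hD) hC
  have hlc' : ∀ r, q + 1 ≤ r → r + 1 ≤ p →
      biIndepNorm M (r - 1) * biIndepNorm M (r + 1) ≤ biIndepNorm M r ^ 2 :=
    fun r hr hr' => hlc r (by omega) (by omega)
  have hend : biIndepNorm M q ≤ biIndepNorm M p := by
    unfold biIndepNorm
    rw [hsym, hE, Nat.choose_symm_add]
  have hmain := lc_symm_ge (biIndepNorm M) q p hpos hlc' hend v hqv hvp
  unfold biIndepNorm at hmain
  rw [hE] at hmain
  have hCq : 0 < ((p + q).choose q : ℚ) := by exact_mod_cast Nat.choose_pos (by omega)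
  have hCv : 0 < ((p + q).choose v : ℚ) := by exact_mod_cast Nat.choose_pos (by omega)
  rw [div_le_div_iff₀ hCq hCv] at hmain
  linarith

/-- **THE INDEPENDENT PART OF OBSERVATION H (g19), CONDITIONAL ON THE LORENTZIAN FACT**: on the tight layer
`i_q·C(p+q, v) ≤ i_v·C(p+q, q)` for every `q ≤ v ≤ p`. -/
theorem indepShadow_cumulative_of_biIndepULC (hULC : BiIndepULC M) {p q v : ℕ} (hn : (gr M).card = p + q)
    (hr : M.eRank = (p : ℕ∞)) (hqv : q ≤ v) (hvp : v ≤ p) :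
    (indepShadow M p q q).card * (p + q).choose v ≤ (indepShadow M p q v).card * (p + q).choose q := by
  have hE : M.E.ncard = p + q := by rw [← card_gr, hn]
  have h := biIndepCount_mul_choose_le_of_biIndepULC M hULC hE hqv hvp
  rw [biIndepCount_eq_card_indepShadow M hn hr q, biIndepCount_eq_card_indepShadow M hn hr v] at h
  have h' : ((indepShadow M p q q).card * (p + q).choose v : ℚ)
      ≤ ((indepShadow M p q v).card * (p + q).choose q : ℚ) := by
    linarith
  exact_mod_cast h'

/-- g19's `IndepShadowCumulative M p q` (the independent part of (SC)), CONDITIONAL on `BiIndepULC M`. -/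
theorem indepShadowCumulative_of_biIndepULC (hULC : BiIndepULC M) {p q : ℕ} (hn : (gr M).card = p + q)
    (hr : M.eRank = (p : ℕ∞)) : IndepShadowCumulative M p q :=
  fun _ hqu hup => indepShadow_cumulative_of_biIndepULC M hULC hn hr hqu.le hup.le

/-- **(BC) ON EVERY TIGHT LAYER, CONDITIONAL ON THE LORENTZIAN FACT `BiIndepULC M`**:
`#𝓑·C(p+q, v) ≤ s_v·C(p+q, q)` for every `q ≤ v ≤ p` — the bottom sets are the bi-independent `q`-sets, the
independent shadow sets `i_v = D_v` are part of the shadow `s_v`, and the profile `D` is cumulative by its ULC. -/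
theorem bottomCumulativeTop_of_biIndepULC (hULC : BiIndepULC M) {p q : ℕ} (hn : (gr M).card = p + q)
    (hr : M.eRank = (p : ℕ∞)) : BottomCumulativeTop M p q := by
  intro v hqv hvp
  rw [card_Uq_eq_card_indepShadow_q M hn hr]
  refine (indepShadow_cumulative_of_biIndepULC M hULC hn hr hqv hvp).trans ?_
  refine Nat.mul_le_mul_right _ ?_
  rw [card_shadowLev_eq_indep_add_dep]
  exact Nat.le_add_right _ _

/-- C-025 on the tight layer through (BC), conditional on `BiIndepULC M` (the unconditional theorem is Theorem M,
`RLS_of_ncard_eq`; this is only the end of the chain (BC) ⟹ C-025). -/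
theorem rls_tight_of_biIndepULC (hULC : BiIndepULC M) {p q : ℕ} (hn : (gr M).card = p + q)
    (hr : M.eRank = (p : ℕ∞)) : ThmN.RLS M p q :=
  rls_of_bottomCumulativeTop M p q (bottomCumulativeTop_of_biIndepULC M hULC hn hr)

end PercRepro.RankDist
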